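import Summits.QuantumFields.YangMills.Theorems.PoincareLipschitzInteriorSupScaleOptimised
import HarnessLib

/-!
# Line «poincare_lipschitz» on crux `HistoryTailL` (stmt-QuantumFields-19936), route crux `BlockLipschitzL` (stmt-QuantumFields-23533), K2 supplier plan —
# THE SCALE-OPTIMISATION LEMMA, CARRIER-FREE: a single-scale interior estimate `X² ≤ A·M²/(ℓ+1)^d + E·ℓ²·θ²` valid at EVERY scale `1 ≤ ℓ ≤ ℓ_max`
# gives `X² ≤ A·M²/(ℓ_max+1)^d + (A+4E)·θ^{2d/(d+2)}·M^{4/(d+2)} + (A+E)·θ²` (d = 3: `X ≲ θ^{3/5}M^{2/5} + ℓ_max^{−3/2}M + θ`)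

Cell `ym3-torus` (YM ladder rung R3 = continuum SU(2) Yang–Mills on the three-torus — a RUNG, NOT the Clay problem: not d = 4, not infinite volume, not a
mass gap); width seat `ym3-torus-px7` gen 4.  Pure real analysis (imports ✓p682131 for its `rpow` letters only), def-free; `--supports stmt-QuantumFields-23533`.  Nothing here proves
`hStab`, (R3), F5/F6, a stub, `BlockLipschitzL`, `HistoryTailL` or a summit statement.

WHY (bus 2026-08-29T00:54Z, located for card v1.27's F6).  The per-level interior-regularity input (R3) of the K2 supplier plan is available — flat
(✓`Prop7FlatSourcedMeanValue.sq_le_of_curl_diverg_bounds_torus`) and, once typed, covariant (w5-19936 g10's (R3)-COV row) — as a SINGLE-SCALE estimate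
`sup² ≤ A·ℓ^{−d}·mass(Q_{cℓ}) + E·ℓ²·θ²` for every admissible scale `ℓ`.  Read at the full box `ℓ ≍ L^{j+1−i}` its source term is the «j ≲ K/2» wall; read at the
OPTIMAL scale `ℓ* = (M/θ)^{2/(d+2)}` it gives `θ^{d/(d+2)}M^{2/(d+2)}`, and summed over the levels of w2-19936 g10's re-gauged induction this is
`≲ γ^{3/10}p^{3/5}·L^{3(j+1−K)/10}/(1−L^{−1/10})` — j-UNIFORMLY small (LOCATE (R3)-LIN #44 §2(b) and the bus arithmetic of 00:54Z).  ✓p682131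
`PoincareLipschitzInteriorSupScaleOptimised.sq_le_scaleOptimised` performs this optimisation entangled with the flat torus lemma; THIS FILE extracts the
optimisation as a carrier-free real lemma, so that F6 applies it VERBATIM to the covariant row (or to any row of the same shape):

* the `rpow` letters are ✓p682131's `rpow_letter_sq`, `rpow_letter_div`, `le_of_rpow_le_one` (imported, not restated).
* ★★ `sq_le_of_forall_scale` — `A, E, M, θ ≥ 0`, `ℓ_max ≥ 1`, and `∀ ℓ ∈ [1, ℓ_max], X² ≤ A/(ℓ+1)^d·M² + E·ℓ²·θ²` ⟹
  `X² ≤ A/(ℓ_max+1)^d·M² + (A + 4E)·θ^{2d/(d+2)}·M^{4/(d+2)} + (A + E)·θ²` (cases `θ = 0`; `t ≤ 1`; `t ≥ ℓ_max`; `ℓ = ⌈t⌉`).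
[folklore]
-/

set_option autoImplicit false

noncomputable section

namespace Summit.QuantumFields.YangMills.Theorems.PoincareLipschitzScaleOptimisation

open Summit.QuantumFields.YangMills.Theorems.PoincareLipschitzInteriorSupScaleOptimised (rpow_letter_sq rpow_letter_div le_of_rpow_le_one)

/-- ★★ **THE SCALE-OPTIMISATION LEMMA.**  If a quantity `X` obeys the single-scale estimate `X² ≤ A/(ℓ+1)^d·M² + E·ℓ²·θ²` at EVERY integer scale
`1 ≤ ℓ ≤ ℓ_max` (`A, E, M, θ ≥ 0`, `ℓ_max ≥ 1`), then
`X² ≤ A/(ℓ_max+1)^d·M² + (A + 4E)·θ^{2d/(d+2)}·M^{4/(d+2)} + (A + E)·θ²` — the estimate at `ℓ* = ⌈(M/θ)^{2/(d+2)}⌉` clamped to `[1, ℓ_max]`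
(`θ = 0`: `ℓ = ℓ_max`).  d = 3: `X ≲ θ^{3/5}M^{2/5} + ℓ_max^{−3/2}M + θ`. [folklore] -/
theorem sq_le_of_forall_scale (d : ℕ) {X M θ A E : ℝ} (hM0 : 0 ≤ M) (hθ0 : 0 ≤ θ) (hA0 : 0 ≤ A) (hE0 : 0 ≤ E)
    {ℓmax : ℕ} (hℓmax : 1 ≤ ℓmax)
    (step : ∀ ℓ : ℕ, 1 ≤ ℓ → ℓ ≤ ℓmax → X ^ 2 ≤ A / ((ℓ : ℝ) + 1) ^ d * M ^ 2 + E * (ℓ : ℝ) ^ 2 * θ ^ 2) :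
    X ^ 2 ≤ A / ((ℓmax : ℝ) + 1) ^ d * M ^ 2 + (A + 4 * E) * (θ ^ ((2 * d : ℝ) / (d + 2)) * M ^ ((4 : ℝ) / (d + 2))) + (A + E) * θ ^ 2 := by
  set Φ : ℝ := θ ^ ((2 * d : ℝ) / (d + 2)) * M ^ ((4 : ℝ) / (d + 2)) with hΦ
  have hΦ0 : 0 ≤ Φ := mul_nonneg (Real.rpow_nonneg hθ0 _) (Real.rpow_nonneg hM0 _)
  have hT1 : 0 ≤ A / ((ℓmax : ℝ) + 1) ^ d * M ^ 2 := by positivity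
  have hT2 : 0 ≤ (A + 4 * E) * Φ := by positivity
  have hT3 : 0 ≤ (A + E) * θ ^ 2 := by positivity
  by_cases hθz : θ = 0
  · have h := step ℓmax hℓmax le_rfl
    have h' : E * (ℓmax : ℝ) ^ 2 * θ ^ 2 = 0 := by rw [hθz]; ring
    linarith [hT2, hT3]
  have hθpos : 0 < θ := lt_of_le_of_ne hθ0 (Ne.symm hθz)
  set t : ℝ := (M / θ) ^ ((2 : ℝ) / (d + 2)) with ht
  have ht0 : 0 ≤ t := Real.rpow_nonneg (div_nonneg hM0 hθpos.le) _
  have hsq : t ^ 2 * θ ^ 2 = Φ := by rw [ht, hΦ]; exact rpow_letter_sq d hθpos hM0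
  by_cases ht1 : t ≤ 1
  · have hMθ : M ≤ θ := le_of_rpow_le_one d hθpos ht1
    have h := step 1 le_rfl hℓmax
    have h1 : A / (((1 : ℕ) : ℝ) + 1) ^ d * M ^ 2 ≤ A * θ ^ 2 := by
      have hden : (1 : ℝ) ≤ (((1 : ℕ) : ℝ) + 1) ^ d := one_le_pow₀ (by norm_num)
      have hAd : A / (((1 : ℕ) : ℝ) + 1) ^ d ≤ A := div_le_self hA0 hden
      have hM2 : M ^ 2 ≤ θ ^ 2 := pow_le_pow_left₀ hM0 hMθ 2
      exact mul_le_mul hAd hM2 (sq_nonneg _) hA0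
    have h2 : E * (((1 : ℕ) : ℝ)) ^ 2 * θ ^ 2 = E * θ ^ 2 := by norm_num
    rw [h2] at h
    have e3 : (A + E) * θ ^ 2 = A * θ ^ 2 + E * θ ^ 2 := by ring
    linarith [h, h1, hT1, hT2, e3]
  · by_cases ht2 : (ℓmax : ℝ) ≤ t
    · have h := step ℓmax hℓmax le_rfl
      have h1 : E * (ℓmax : ℝ) ^ 2 * θ ^ 2 ≤ E * Φ := by
        rw [← hsq, mul_assoc]
        refine mul_le_mul_of_nonneg_left ?_ hE0
        have hl0 : (0 : ℝ) ≤ ℓmax := by positivity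
        exact mul_le_mul_of_nonneg_right (pow_le_pow_left₀ hl0 ht2 2) (sq_nonneg _)
      have e3 : (A + 4 * E) * Φ = A * Φ + 4 * (E * Φ) := by ring
      have hAΦ : 0 ≤ A * Φ := mul_nonneg hA0 hΦ0
      have hEΦ : 0 ≤ E * Φ := mul_nonneg hE0 hΦ0
      linarith [h, h1, hT3, e3, hAΦ, hEΦ]
    · have ht1' : 1 < t := lt_of_not_ge ht1
      have ht2' : t < ℓmax := lt_of_not_ge ht2
      have htpos : 0 < t := lt_trans zero_lt_one ht1'
      set ℓ : ℕ := ⌈t⌉₊ with hℓ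
      have hℓ1 : 1 ≤ ℓ := Nat.one_le_iff_ne_zero.mpr (Nat.pos_iff_ne_zero.mp (Nat.ceil_pos.mpr htpos))
      have hℓ2 : ℓ ≤ ℓmax := Nat.ceil_le.mpr ht2'.le
      have hℓt : t ≤ (ℓ : ℝ) := Nat.le_ceil t
      have hℓt' : (ℓ : ℝ) < t + 1 := Nat.ceil_lt_add_one ht0
      have h := step ℓ hℓ1 hℓ2
      have hMpos : 0 < M := by
        by_contra hM'
        have hM00 : M = 0 := le_antisymm (le_of_not_gt hM') hM0
        have : t = 0 := by
          rw [ht, hM00, zero_div]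
          exact Real.zero_rpow (by positivity)
        linarith
      have hdiv : M ^ 2 / t ^ d = Φ := by rw [ht, hΦ]; exact rpow_letter_div d hθpos hMpos
      have h1 : A / ((ℓ : ℝ) + 1) ^ d * M ^ 2 ≤ A * Φ := by
        rw [← hdiv]
        have hpow : t ^ d ≤ ((ℓ : ℝ) + 1) ^ d := pow_le_pow_left₀ htpos.le (by linarith) _
        have htd : 0 < t ^ d := pow_pos htpos _
        have e1 : A / ((ℓ : ℝ) + 1) ^ d * M ^ 2 = A * (M ^ 2 / ((ℓ : ℝ) + 1) ^ d) := by ring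
        rw [e1]
        refine mul_le_mul_of_nonneg_left ?_ hA0
        exact div_le_div_of_nonneg_left (sq_nonneg _) htd hpow
      have h2 : E * (ℓ : ℝ) ^ 2 * θ ^ 2 ≤ 4 * E * Φ := by
        rw [← hsq]
        have hl : (ℓ : ℝ) ^ 2 ≤ 4 * t ^ 2 := by
          have h2t : (ℓ : ℝ) ≤ 2 * t := by linarith
          have hl0 : (0 : ℝ) ≤ ℓ := by positivity
          have := pow_le_pow_left₀ hl0 h2t 2
          linarith [this, (by ring : (2 * t) ^ 2 = 4 * t ^ 2)]
        have := mul_le_mul_of_nonneg_left (mul_le_mul_of_nonneg_right hl (sq_nonneg θ)) hE0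
        linarith
      have e3 : (A + 4 * E) * Φ = A * Φ + 4 * E * Φ := by ring
      linarith [h, h1, h2, hT1, hT3, e3]

/-- **COROLLARY (square roots taken)**: under the same hypotheses with `X ≥ 0`,
`X ≤ √A·M/(ℓ_max+1)^{d/2} + √(A+4E)·√(θ^{2d/(d+2)}·M^{4/(d+2)}) + √(A+E)·θ` (`√(a+b+c) ≤ √a+√b+√c`). [folklore] -/
theorem le_of_forall_scale (d : ℕ) {X M θ A E : ℝ} (hX0 : 0 ≤ X) (hM0 : 0 ≤ M) (hθ0 : 0 ≤ θ) (hA0 : 0 ≤ A) (hE0 : 0 ≤ E)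
    {ℓmax : ℕ} (hℓmax : 1 ≤ ℓmax)
    (step : ∀ ℓ : ℕ, 1 ≤ ℓ → ℓ ≤ ℓmax → X ^ 2 ≤ A / ((ℓ : ℝ) + 1) ^ d * M ^ 2 + E * (ℓ : ℝ) ^ 2 * θ ^ 2) :
    X ≤ Real.sqrt (A / ((ℓmax : ℝ) + 1) ^ d * M ^ 2) + Real.sqrt ((A + 4 * E) * (θ ^ ((2 * d : ℝ) / (d + 2)) * M ^ ((4 : ℝ) / (d + 2)))) +
      Real.sqrt ((A + E) * θ ^ 2) := by
  have h := sq_le_of_forall_scale d hM0 hθ0 hA0 hE0 hℓmax step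
  have hΦ0 : 0 ≤ θ ^ ((2 * d : ℝ) / (d + 2)) * M ^ ((4 : ℝ) / (d + 2)) := mul_nonneg (Real.rpow_nonneg hθ0 _) (Real.rpow_nonneg hM0 _)
  have h1 : 0 ≤ A / ((ℓmax : ℝ) + 1) ^ d * M ^ 2 := by positivity
  have h2 : 0 ≤ (A + 4 * E) * (θ ^ ((2 * d : ℝ) / (d + 2)) * M ^ ((4 : ℝ) / (d + 2))) := by positivity
  have h3 : 0 ≤ (A + E) * θ ^ 2 := by positivity
  -- `√(a+b) ≤ √a + √b` (inlined; many private copies exist in the tree)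
  have hsal : ∀ a b : ℝ, 0 ≤ a → 0 ≤ b → Real.sqrt (a + b) ≤ Real.sqrt a + Real.sqrt b := by
    intro a b ha hb
    have hs : 0 ≤ Real.sqrt a + Real.sqrt b := add_nonneg (Real.sqrt_nonneg _) (Real.sqrt_nonneg _)
    have hsq : a + b ≤ (Real.sqrt a + Real.sqrt b) ^ 2 := by
      have e : (Real.sqrt a + Real.sqrt b) ^ 2 = a + b + 2 * (Real.sqrt a * Real.sqrt b) := by
        rw [add_sq, Real.sq_sqrt ha, Real.sq_sqrt hb]; ring
      rw [e]
      have : 0 ≤ Real.sqrt a * Real.sqrt b := mul_nonneg (Real.sqrt_nonneg _) (Real.sqrt_nonneg _)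
      linarith
    calc Real.sqrt (a + b) ≤ Real.sqrt ((Real.sqrt a + Real.sqrt b) ^ 2) := Real.sqrt_le_sqrt hsq
      _ = Real.sqrt a + Real.sqrt b := Real.sqrt_sq hs
  have hX : X = Real.sqrt (X ^ 2) := (Real.sqrt_sq hX0).symm
  rw [hX]
  calc Real.sqrt (X ^ 2) ≤ Real.sqrt (A / ((ℓmax : ℝ) + 1) ^ d * M ^ 2 + (A + 4 * E) * (θ ^ ((2 * d : ℝ) / (d + 2)) * M ^ ((4 : ℝ) / (d + 2))) +
        (A + E) * θ ^ 2) := Real.sqrt_le_sqrt h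
    _ ≤ Real.sqrt (A / ((ℓmax : ℝ) + 1) ^ d * M ^ 2 + (A + 4 * E) * (θ ^ ((2 * d : ℝ) / (d + 2)) * M ^ ((4 : ℝ) / (d + 2)))) +
        Real.sqrt ((A + E) * θ ^ 2) := hsal _ _ (by positivity) h3
    _ ≤ Real.sqrt (A / ((ℓmax : ℝ) + 1) ^ d * M ^ 2) + Real.sqrt ((A + 4 * E) * (θ ^ ((2 * d : ℝ) / (d + 2)) * M ^ ((4 : ℝ) / (d + 2)))) +
        Real.sqrt ((A + E) * θ ^ 2) := by
        have := hsal _ _ h1 h2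
        linarith

end Summit.QuantumFields.YangMills.Theorems.PoincareLipschitzScaleOptimisation

end
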